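import Summits.RiemannHypothesis.RiemannHypothesis.Theorems.GroundBartaEvenWinsBeyondArchDeflationN25EEvenLowerGWX
import Summits.RiemannHypothesis.RiemannHypothesis.Theorems.GroundBartaEvenWinsBeyondArchDeflationN25OOddLowerGWX
import Summits.RiemannHypothesis.RiemannHypothesis.Theorems.WeilParityEvenWinsBeyondArchThreePrimeWindowCompleteOfOddLower
import HarnessLib

/-!
# RiemannHypothesis / GroundBarta — rung 4 (`EvenWinsBeyondArch`): the ENDPOINT `a* = (log 5)/2` — the complete three-prime window

Helper file (`--supports stmt-RiemannHypothesis-18085`), RH-free.  Prover B (gen 6 of unit `sr-gb-rung-b`) closing prover A's endpoint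
implications (`…FrontierLog5HalfOfBlocks`, `…ThreePrimeWindowCompleteOfOddLower`, prover A g10) with the two endpoint blocks of this unit:
`n25E_evenLower_lit : 0 ≤ ε_ev((log 5)/2)` and `n25O_oddLower_lit : 10⁻¹⁵ ≤ ε_od((log 5)/2)` (deflated Temple criterion, thin-shell convergent
geometry, certificates E25E / E25O, A-layers N25E / N25O, R-layers RN25E / RN25O).

* `weilPositivityOn_log5half` — **Weil's quadratic form is non-negative on every test function supported in `[-(log 5)/2, (log 5)/2]`**
  (the closed three-prime window; primes 2, 3, 4 visible), unconditionally.
* `weilWindowSimpleEven_upTo_log5half` — the ground state of every window `a ∈ (0, (log 5)/2]` is simple-even: `ε_ev(a) < ε_od(a)`.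
* the residues: `NoParityCrossing`, `GroundStateSimpleEven`, `EvenWinsBeyondArch` ⟺ their restrictions to the windows beyond `(log 5)/2`.
-/

set_option linter.dupNamespace false

noncomputable section

open Set MeasureTheory

namespace Summit.RiemannHypothesis.RiemannHypothesis.Theorems.EvenWinsBeyondArch

open Literature.NumberTheory.LFunctions
open Summit.RiemannHypothesis.RiemannHypothesis.Theses.WeilParity
open Summit.RiemannHypothesis.RiemannHypothesis.Theses.WeilGroundState

/-- `10⁻¹⁷ < 10⁻¹⁵`. [folklore] -/
theorem n25O_oddLower_threshold : (1 / 100000000000000000 : ℝ) < (1 : ℝ) / 1000000000000000 := by norm_num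

/-- **`0 ≤ ε_od((log 5)/2)`**. [folklore] -/
theorem weilOddGroundEnergy_log5half_nonneg : 0 ≤ weilOddGroundEnergy (Real.log 5 / 2) :=
  le_trans (by norm_num) n25O_oddLower_lit

/-- **Weil positivity on the closed three-prime window `[-(log 5)/2, (log 5)/2]`.** [folklore] -/
theorem weilPositivityOn_log5half : WeilPositivityOn (Real.log 5 / 2) :=
  weilPositivityOn_log5half_of_blocks n25E_evenLower_lit weilOddGroundEnergy_log5half_nonneg

/-- Weil positivity on every window `a ≤ (log 5)/2`. [folklore] -/
theorem weilPositivityOn_of_le_log5half {a : ℝ} (ha : a ≤ Real.log 5 / 2) : WeilPositivityOn a :=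
  weilPositivityOn_of_le_log5half_of_blocks n25E_evenLower_lit weilOddGroundEnergy_log5half_nonneg ha

/-- The bottom of Weil's form on the closed three-prime window is non-negative. [folklore] -/
theorem weilGroundEnergy_log5half_nonneg : 0 ≤ weilGroundEnergy (Real.log 5 / 2) :=
  weilGroundEnergy_log5half_nonneg_of_blocks n25E_evenLower_lit weilOddGroundEnergy_log5half_nonneg

/-- **Every window `a ∈ (0, (log 5)/2]` is simple-even.** [folklore] -/
theorem weilWindowSimpleEven_upTo_log5half : ∀ a : ℝ, 0 < a → a ≤ Real.log 5 / 2 → WeilWindowSimpleEven a :=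
  weilWindowSimpleEven_upTo_log5half_of_oddLower n25O_oddLower_threshold n25O_oddLower_lit

/-- **Strict parity order `ε_ev(a) < ε_od(a)` on the complete three-prime window `(0, (log 5)/2]`.** [folklore] -/
theorem weilEvenGroundEnergy_lt_weilOddGroundEnergy_of_le_log5half {a : ℝ} (ha : 0 < a) (hhi : a ≤ Real.log 5 / 2) :
    weilEvenGroundEnergy a < weilOddGroundEnergy a :=
  weilEvenGroundEnergy_lt_weilOddGroundEnergy_of_le_log5half_of_oddLower n25O_oddLower_threshold n25O_oddLower_lit ha hhi

/-- Ground states of every window `a ∈ (0, (log 5)/2]` are a.e. even. [folklore] -/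
theorem groundStates_ae_even_of_le_log5half :
    ∀ a : ℝ, 0 < a → a ≤ Real.log 5 / 2 → ∀ u : ℝ → ℂ, IsWeilGroundState a u → u =ᵐ[volume] fun t ↦ u (-t) :=
  groundStates_ae_even_of_le_log5half_of_oddLower n25O_oddLower_threshold n25O_oddLower_lit

/-- **Residue of `NoParityCrossing` (stmt-RiemannHypothesis-18085)**: it is equivalent to its restriction beyond `(log 5)/2`. [folklore] -/
theorem noParityCrossing_iff_beyond_log5half :
    NoParityCrossing ↔ ∀ a : ℝ, Real.log 5 / 2 < a → weilEvenGroundEnergy a ≠ weilOddGroundEnergy a :=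
  noParityCrossing_iff_beyond_log5half_of_oddLower n25O_oddLower_threshold n25O_oddLower_lit

/-- **Residue of `GroundStateSimpleEven` (stmt-RiemannHypothesis-1526)**. [folklore] -/
theorem groundStateSimpleEven_iff_tailSimpleEven_log5half :
    GroundStateSimpleEven ↔ ∀ a : ℝ, Real.log 5 / 2 < a → WeilWindowSimpleEven a :=
  groundStateSimpleEven_iff_tailSimpleEven_log5half_of_oddLower n25O_oddLower_threshold n25O_oddLower_lit

/-- **Residue of `EvenWinsBeyondArch` (GroundBarta rung 4, stmt-RiemannHypothesis-18807)**: it is equivalent to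
`ε_ev ≤ ε_od` beyond `(log 5)/2`. [folklore] -/
theorem evenWinsBeyondArch_iff_forall_le_beyond_log5half :
    EvenWinsBeyondArch ↔ ∀ a : ℝ, Real.log 5 / 2 < a → weilEvenGroundEnergy a ≤ weilOddGroundEnergy a :=
  evenWinsBeyondArch_iff_forall_le_beyond_log5half_of_oddLower n25O_oddLower_threshold n25O_oddLower_lit

end Summit.RiemannHypothesis.RiemannHypothesis.Theorems.EvenWinsBeyondArch

end
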